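import Summits.ResolutionOfSingularities.ResolutionOfSingularities.Theorems.FrobeniusClosingPatchingRelPerfectCompanionKernel
import Literature.AlgebraicGeometry.Resolution.RegularBlowup
import Literature.AlgebraicGeometry.Resolution.AdicCompletionRegular
import Literature.AlgebraicGeometry.Resolution.GenericFibreResolutionDatum
import Literature.AlgebraicGeometry.Resolution.BlowupChartMembership
import Literature.AlgebraicGeometry.Resolution.BlowupsExistence
import HarnessLib

/-!
# Crux `PatchingRelPerfect` (stmt-ResolutionOfSingularities-16161), chain w52 — CORE RUNG r0:
# the blow-up-form open core on POWERS OF THE MAXIMAL IDEAL and on PRINCIPAL ideals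

[OURS · L1 W5.2 · rung] The open core of skeleton v5 is `stub_atomDimFourBlowup`
(`AtomDimFourBlowupAt p`): for `S` complete regular local of dimension `4`, characteristic `p`,
perfect residue field, `I ≠ 0` an ideal and `T = Bl_I Spec S` regular off the closed fibre, a
non-zero fibre-cosupported ideal sheaf on `T` with regular blowing up.  CHAIN.md v0.3 asks idle
seats for RUNGS — the statement restricted to named families of ideals, the first family being the
𝔪-primary MONOMIAL ideals (toric germs).  This file lands the first, cheapest members, in EVERY
dimension and for EVERY regular local base (no completeness, characteristic or residue-field
hypothesis is used):

* `I = 𝔪ᵈ` (`d ≥ 0`): `Bl_{𝔪ᵈ} Spec S ≅ Bl_𝔪 Spec S` is REGULAR (blowing up a regular scheme in a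
  regular centre — the closed point; tree `IsBlowup.isRegular_of_isRegular_subscheme`), so the
  atom's conclusion holds with `J = 𝒪_T` (companion `Q = S`);
* `I = (a)` principal, `a ≠ 0`: `Ĩ` is an effective Cartier divisor, the blowing up is an
  isomorphism, `T ≅ Spec S` is regular.

Results: `isRegular_subscheme_idealSheaf_maximalIdeal`, `isRegular_Spec_of_isRegularLocalRing`,
`isRegular_of_isBlowup_maximalIdeal`, `isBlowup_pow_maximalIdeal`,
`isRegular_of_isBlowup_pow_maximalIdeal`, `isRegular_of_isBlowup_span_singleton`,
`atomConclusion_of_isRegular`, and the rungs `coreRung_pow_maximalIdeal`,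
`coreRung_span_singleton` (shape of `AtomDimFourBlowupAt`, restricted).  BC5-type evidence for the
core on degenerate strata only; the first non-trivial monomial members (e.g. the squarefree
Veronese ideal, CHAIN r2) are NOT covered.  Nothing here is a statement of the manuscript under
review.

## References

* The Stacks Project, Tags 080A, 0804, 02ND. [StacksProject]
* H. Matsumura, *Commutative Ring Theory*, CUP 1986, Thm. 19.3 (Serre). [Matsumura1987]
* U. Görtz, T. Wedhorn, *Algebraic Geometry I* (2nd ed., 2020), Def. 13.90, (13.19). [GortzWedhorn2020]
-/

-- `Summit.<Summit>.<Sub>.Theorems` with `Sub = Summit` (single-conjunct summit, D-0017)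
set_option linter.dupNamespace false

noncomputable section

open CategoryTheory CategoryTheory.Limits AlgebraicGeometry Literature.AlgebraicGeometry.Resolution
open Summit.ResolutionOfSingularities.ResolutionOfSingularities.Theorems.PatchingRelPerfect.Negative
  (isBlowup_ne_bot_of_nonempty)

namespace Summit.ResolutionOfSingularities.ResolutionOfSingularities.Theorems

universe u

/-- **The centre `V(𝔪)` of a local scheme is regular**: the closed subscheme of `Spec S` cut out
by the ideal sheaf of the maximal ideal is `Spec` of the residue field. [folklore] -/
theorem isRegular_subscheme_idealSheaf_maximalIdeal (S : Type u) [CommRing S] [IsLocalRing S] :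
    Scheme.IsRegular (affineBlowup.idealSheaf (IsLocalRing.maximalIdeal S)).subscheme := by
  let j : Spec (.of (S ⧸ IsLocalRing.maximalIdeal S)) ⟶ Spec (.of S) :=
    Spec.map (CommRingCat.ofHom (Ideal.Quotient.mk (IsLocalRing.maximalIdeal S)))
  haveI : IsClosedImmersion j :=
    IsClosedImmersion.spec_of_surjective _ Ideal.Quotient.mk_surjective
  have hker : (affineBlowup.idealSheaf (IsLocalRing.maximalIdeal S)).subschemeι.ker = j.ker := by
    rw [Scheme.IdealSheafData.ker_subschemeι, ker_specMap_quotient_mk]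
  haveI := IsClosedImmersion.isIso_lift _ j hker
  have hreg : Scheme.IsRegular (Spec (.of (S ⧸ IsLocalRing.maximalIdeal S))) := by
    letI : Field (S ⧸ IsLocalRing.maximalIdeal S) :=
      inferInstanceAs (Field (IsLocalRing.ResidueField S))
    haveI : IsRegularRing (CommRingCat.of (S ⧸ IsLocalRing.maximalIdeal S)) :=
      inferInstanceAs (IsRegularRing (S ⧸ IsLocalRing.maximalIdeal S))
    exact Scheme.isRegular_Spec _
  exact Scheme.IsRegular.of_isOpenImmersion (inv (IsClosedImmersion.lift _ j hker.le)) hreg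

/-- `Spec` of a regular local ring is a regular scheme (Serre: a regular local ring is a regular
ring, tree `isRegularRing_of_isRegularLocalRing`). [cite: Matsumura1987, Thm. 19.3] -/
theorem isRegular_Spec_of_isRegularLocalRing (S : Type u) [CommRing S] [IsRegularLocalRing S] :
    Scheme.IsRegular (Spec (.of S)) := by
  haveI : IsRegularRing (CommRingCat.of S) := isRegularRing_of_isRegularLocalRing S
  exact Scheme.isRegular_Spec _

/-- **Blowing up the closed point of a regular local scheme gives a regular scheme** (regular
centre in a regular scheme). [cite: StacksProject, Tag 0804] -/
theorem isRegular_of_isBlowup_maximalIdeal {S : Type u} [CommRing S] [IsRegularLocalRing S]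
    {T : Scheme.{u}} {f : T ⟶ Spec (.of S)}
    (hf : IsBlowup f (affineBlowup.idealSheaf (IsLocalRing.maximalIdeal S))) :
    Scheme.IsRegular T := by
  haveI : IsNoetherianRing (CommRingCat.of S) := (inferInstance : IsNoetherianRing S)
  exact hf.isRegular_of_isRegular_subscheme (isRegular_Spec_of_isRegularLocalRing S)
    (isRegular_subscheme_idealSheaf_maximalIdeal S)

/-- **The blowing up of `𝔪` is a blowing up of every power `𝔪ᵈ`, `d ≥ 1`** (Stacks 080A with the
exceptional divisor Cartier upstairs: `IsBlowup.comp` with the identity).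
[cite: StacksProject, Tag 080A] -/
theorem isBlowup_pow_maximalIdeal {S : Type u} [CommRing S] [IsLocalRing S] {B : Scheme.{u}}
    {π : B ⟶ Spec (.of S)}
    (hπ : IsBlowup π (affineBlowup.idealSheaf (IsLocalRing.maximalIdeal S)))
    (d : ℕ) (hd : 0 < d) :
    IsBlowup π (affineBlowup.idealSheaf (IsLocalRing.maximalIdeal S ^ d)) := by
  induction d with
  | zero => exact absurd hd (lt_irrefl 0)
  | succ d ih =>
    rcases Nat.eq_zero_or_pos d with h0 | hpos
    · subst h0
      simpa using hπ
    · have h1 := ih hpos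
      have h2 : IsBlowup (𝟙 B)
          ((affineBlowup.idealSheaf (IsLocalRing.maximalIdeal S)).comap π) :=
        IsBlowup.id hπ.isEffectiveCartier
      have h3 := h1.comp h2
      rw [Category.id_comp, ← affineBlowup.idealSheaf_mul, ← pow_succ] at h3
      exact h3

/-- **A blowing up of `Spec S` along `𝔪ᵈ` is regular** (`S` regular local; `d = 0`: the blowing
up along the unit ideal is an isomorphism; `d ≥ 1`: it is the blowing up of `𝔪` by uniqueness).
[cite: StacksProject, Tag 080A] [cite: GortzWedhorn2020, (13.19) p. 413] -/
theorem isRegular_of_isBlowup_pow_maximalIdeal {S : Type u} [CommRing S] [IsRegularLocalRing S]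
    {T : Scheme.{u}} {f : T ⟶ Spec (.of S)} (d : ℕ)
    (hf : IsBlowup f (affineBlowup.idealSheaf (IsLocalRing.maximalIdeal S ^ d))) :
    Scheme.IsRegular T := by
  rcases Nat.eq_zero_or_pos d with h0 | hpos
  · subst h0
    rw [pow_zero, Ideal.one_eq_top, affineBlowup.idealSheaf_top] at hf
    haveI : IsIso f := hf.isIso isEffectiveCartier_top
    exact SectionAscent.TraceIdeal.isRegular_of_iso (asIso f)
      (isRegular_Spec_of_isRegularLocalRing S)
  · obtain ⟨B, π, hπ⟩ :=
      exists_isBlowup (Spec (.of S)) (affineBlowup.idealSheaf (IsLocalRing.maximalIdeal S))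
    obtain ⟨e, -, -⟩ := hf.unique (isBlowup_pow_maximalIdeal hπ d hpos)
    exact SectionAscent.TraceIdeal.isRegular_of_iso e (isRegular_of_isBlowup_maximalIdeal hπ)

/-- **A blowing up of `Spec S` along a non-zero principal ideal is regular** (`S` regular local,
hence a domain: `(a)~` is an effective Cartier divisor, so the blowing up is an isomorphism).
[cite: GortzWedhorn2020, (13.19) p. 413] -/
theorem isRegular_of_isBlowup_span_singleton {S : Type u} [CommRing S] [IsRegularLocalRing S]
    {T : Scheme.{u}} {f : T ⟶ Spec (.of S)} {a : S} (ha : a ≠ 0)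
    (hf : IsBlowup f (affineBlowup.idealSheaf (Ideal.span {a}))) : Scheme.IsRegular T := by
  haveI : IsDomain S := isDomain_of_isRegularLocalRing S
  haveI : IsIso f := hf.isIso
    (affineBlowup.isEffectiveCartier_idealSheaf_span_singleton (mem_nonZeroDivisors_of_ne_zero ha))
  exact SectionAscent.TraceIdeal.isRegular_of_iso (asIso f)
    (isRegular_Spec_of_isRegularLocalRing S)

/-- **A regular non-empty `T` over a local base satisfies the atom's conclusion trivially**
(`J = 𝒪_T`, the identity blowing up). [folklore] -/
theorem atomConclusion_of_isRegular {S : Type u} [CommRing S] [IsLocalRing S] {T : Scheme.{u}}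
    (f : T ⟶ Spec (.of S)) [Nonempty T] (hT : Scheme.IsRegular T) :
    ∃ (J : T.IdealSheafData) (T' : Scheme.{u}) (π : T' ⟶ T), J ≠ ⊥ ∧
      (∀ t : T, t ∈ J.support → f.base t = IsLocalRing.closedPoint S) ∧
      IsBlowup π J ∧ Scheme.IsRegular T' := by
  refine ⟨⊤, T, 𝟙 T, isBlowup_ne_bot_of_nonempty (isBlowup_id_top T), fun t ht => ?_,
    isBlowup_id_top T, hT⟩
  exfalso
  rw [Scheme.IdealSheafData.support_top] at ht
  have h' : t ∈ ((⊥ : TopologicalSpace.Closeds T) : Set T) := ht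
  simp at h'

/-- **CORE RUNG r0 (powers of the maximal ideal).** The blow-up-form open core
`AtomDimFourBlowupAt` restricted to the family `I = 𝔪ᵈ` holds — in every dimension and for every
regular local base, with companion `Q = S`: `T = Bl_{𝔪ᵈ} Spec S` is regular, so `J = 𝒪_T` works.
BC5-type evidence on the most degenerate 𝔪-primary monomial stratum only.
[cite: StacksProject, Tag 080A] -/
theorem coreRung_pow_maximalIdeal {S : Type u} [CommRing S] [IsRegularLocalRing S] (d : ℕ)
    (hI : IsLocalRing.maximalIdeal S ^ d ≠ ⊥) (T : Scheme.{u}) (f : T ⟶ Spec (.of S))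
    (hf : IsBlowup f (affineBlowup.idealSheaf (IsLocalRing.maximalIdeal S ^ d))) :
    ∃ (J : T.IdealSheafData) (T' : Scheme.{u}) (π : T' ⟶ T), J ≠ ⊥ ∧
      (∀ t : T, t ∈ J.support → f.base t = IsLocalRing.closedPoint S) ∧
      IsBlowup π J ∧ Scheme.IsRegular T' := by
  haveI : IsDomain S := isDomain_of_isRegularLocalRing S
  haveI : IsDomain (CommRingCat.of S) := ‹IsDomain S›
  haveI : IsIntegral T := hf.isIntegral (affineBlowup.idealSheaf_ne_bot hI)
  exact atomConclusion_of_isRegular f (isRegular_of_isBlowup_pow_maximalIdeal d hf)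

/-- **CORE RUNG r0′ (principal ideals).** The blow-up-form open core restricted to non-zero
principal ideals holds trivially: `Bl_{(a)} Spec S = Spec S`.
[cite: GortzWedhorn2020, (13.19) p. 413] -/
theorem coreRung_span_singleton {S : Type u} [CommRing S] [IsRegularLocalRing S] {a : S}
    (ha : a ≠ 0) (T : Scheme.{u}) (f : T ⟶ Spec (.of S))
    (hf : IsBlowup f (affineBlowup.idealSheaf (Ideal.span {a}))) :
    ∃ (J : T.IdealSheafData) (T' : Scheme.{u}) (π : T' ⟶ T), J ≠ ⊥ ∧
      (∀ t : T, t ∈ J.support → f.base t = IsLocalRing.closedPoint S) ∧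
      IsBlowup π J ∧ Scheme.IsRegular T' := by
  haveI : IsDomain S := isDomain_of_isRegularLocalRing S
  haveI : IsDomain (CommRingCat.of S) := ‹IsDomain S›
  have hI : Ideal.span ({a} : Set S) ≠ ⊥ := by
    rw [Ne, Ideal.span_singleton_eq_bot]
    exact ha
  haveI : IsIntegral T := hf.isIntegral (affineBlowup.idealSheaf_ne_bot hI)
  exact atomConclusion_of_isRegular f (isRegular_of_isBlowup_span_singleton ha hf)

end Summit.ResolutionOfSingularities.ResolutionOfSingularities.Theorems

end
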